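import Mathlib
import Summits.MatrixMultiplication.MatrixMultiplication.Theorems.SnSubsetDichotomyHyperoctahedralThresholdNearSymmetry

/-!
# `SnSubsetDichotomy.HyperoctahedralThreshold` — large-order near-symmetries give clean twins

Helper file for crux `stmt-MatrixMultiplication-10883` (line `refutation-local-symmetry`, open core
`stub_poorRigidCore`; siege seat k25, variation "supply/tip dichotomy").  Companion of
`…NearSymmetry` (involutive near-symmetries) and `…InvolutiveTwin`.

Setting as there: three fixed-point-free involutions `μ c` of `Fin n`, words acting on the right, trajectories
`x_t := x · z.take t`.  The involutive case used the rung walk `t ↦ {x_t, θ x_t}`, clean because crossed rungs close up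
under `θ² = 1`.  For a permutation `θ` of LARGE order the crossing itself is avoided by counting (crux NOTES §3 "cyclic
covers": deck translates `θ^j W` of one closed walk `W` meet `W` for at most `|W|²` values of `j`):

* `largeOrderSymmetry_cleanWalk` — let `θ : Equiv.Perm (Fin n)`, `m : ℕ`, and let `F` contain every point `v` at which
  one of the following fails: all translates `θ^j v` (`j < m`) avoid `R`; `θ` commutes with the three colours at every
  `θ^j v` (`j < m`); the translates `θ^j v` (`j < m`) are pairwise distinct (freeness up to `m`, e.g. `⟨θ⟩` semiregular of
  order `≥ m`).  If `F` satisfies the counting hypothesis of the `F`-avoiding supply (`closedWalk_avoiding`: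
  `n(n-1) + 2^L(2L+2)|F| < 2^L n`) and `m ≥ (4L+2)² + 2`, there is clean core-format data with `2 ≤ k+1 ≤ 4L+2` rungs
  avoiding `R`.  Proof: along the `F`-avoiding closed walk `(x, z)` (`|z| = ℓ ≤ 4L+2`) every translate `θ^j x`, `j < m`,
  is a fixed point of `z` with trajectory `θ^j x_t` (`NearSymmetry.take_foldl_theta`, induction on `j`) and the same
  self-pattern; a translate CROSSES the base (`x_s = θ^j x_t` for some `s, t`) for at most `ℓ²` values of `j` (for fixed
  `(s, t)` at most one `j`, by freeness at `x_t`), so some `j ∈ [1, m)` does not, and `(x, θ^j x)` is a clean twin by the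
  landed `patternPair_cleanWalk` (siege seat k20).

Together with `nearInvolution_cleanWalk` (order `2`, hence every even order via `θ^{m/2}`) this discharges, for the
one-gadget-with-`R` form of the core and without expander or poorness inputs, every host carrying a free near-action of
a cyclic group of even order or of order `> (4 log₂ n + 10)²`; the residual symmetric case is a free near-action of ODD
order `≤ (4 log₂ n + 10)²` with no involutive or large-order companion (crux NOTES §14.3, the deck-translate counting
regime).  Registered form: `stub_largeOrderSymmetryWalk` (verbatim wrapper).  Pure finite combinatorics. [folklore]
-/

-- the project's summit namespace `Summit.MatrixMultiplication.MatrixMultiplication` repeats a component by design (D-0022)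

set_option linter.dupNamespace false

namespace Summit.MatrixMultiplication.MatrixMultiplication.Theorems.HyperoctahedralThreshold

open Equiv

open NearSymmetry in
/-- **Large-order near-symmetries give clean twins** (finite form; see the module docstring).  `θ` is any permutation;
outside `F` its first `m` translates avoid `R`, see `θ` commute with the colours, and are pairwise distinct; `m ≥ (4L+2)²+2`
and the counting hypothesis of `closedWalk_avoiding` then give clean closed-rung-walk data in the output format of the
line's core, `2 ≤ k + 1 ≤ 4L + 2`, all points outside `R` — the twin `(x, θ^j x)` for a non-crossing translate `j ≠ 0`,
which exists because each ordered pair of positions is crossed by at most one translate. [folklore] -/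
theorem largeOrderSymmetry_cleanWalk (n L m : ℕ) (μ : Fin 3 → Equiv.Perm (Fin n)) (hμ : ∀ c, μ c * μ c = 1)
    (hfpf : ∀ c v, μ c v ≠ v) (θ : Equiv.Perm (Fin n)) (R F : Finset (Fin n))
    (hF : ∀ v, v ∉ F → (∀ j, j < m → (θ ^ j) v ∉ R) ∧
      (∀ j, j < m → ∀ c, θ (μ c ((θ ^ j) v)) = μ c (θ ((θ ^ j) v))) ∧
      (∀ j j', j < m → j' < m → (θ ^ j) v = (θ ^ j') v → j = j'))
    (hm : (4 * L + 2) ^ 2 + 2 ≤ m)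
    (hcount : n * (n - 1) + 2 ^ L * ((2 * L + 2) * F.card) < 2 ^ L * n) :
    ∃ (k : ℕ) (p q : Fin (k + 1) → Fin n) (col : Fin (k + 1) → Fin 3), (∀ i, p i ≠ q i) ∧
      (∀ i, (μ (col i) (p i) = p (i + 1) ∧ μ (col i) (q i) = q (i + 1)) ∨
        (μ (col i) (p i) = q (i + 1) ∧ μ (col i) (q i) = p (i + 1))) ∧
      (∀ i, col i ≠ col (i + 1)) ∧
      (∀ i j, (p i = p j ∧ q i = q j) ∨ (p i = q j ∧ q i = p j) ∨
        (p i ≠ p j ∧ p i ≠ q j ∧ q i ≠ p j ∧ q i ≠ q j)) ∧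
      (∀ i, p i ∉ R ∧ q i ∉ R) ∧ 2 ≤ k + 1 ∧ k + 1 ≤ 4 * L + 2 := by
  classical
  obtain ⟨x, z, _, hzc, hz2, hzle, hzfix, hzF⟩ := closedWalk_avoiding n L μ hμ hfpf F hcount
  -- commutation defect set of `θ`
  obtain ⟨Fθ, hFθ_def⟩ : ∃ Fθ : Finset (Fin n),
      Fθ = (Finset.univ : Finset (Fin n)).filter (fun v => ∃ c, θ (μ c v) ≠ μ c (θ v)) := ⟨_, rfl⟩
  have hFθ : ∀ v, v ∉ Fθ → ∀ c, θ (μ c v) = μ c (θ v) := by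
    intro v hv c
    by_contra h
    exact hv (by rw [hFθ_def]; simp only [Finset.mem_filter, Finset.mem_univ, true_and]; exact ⟨c, h⟩)
  -- trajectories of the translates `θ^j x`, `j < m`
  have htraj : ∀ j, j < m → ∀ i : ℕ, (z.take i).foldl (fun v c => μ c v) ((θ ^ j) x) =
      (θ ^ j) ((z.take i).foldl (fun v c => μ c v) x) := by
    intro j
    induction j with
    | zero => intro _ i; simp
    | succ j ih =>
      intro hj i
      have ih' := ih (Nat.lt_of_succ_lt hj)
      have hgoodj : ∀ i' : ℕ, (z.take i').foldl (fun v c => μ c v) ((θ ^ j) x) ∉ Fθ := by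
        intro i'
        rw [ih' i', hFθ_def]
        intro hmem
        simp only [Finset.mem_filter, Finset.mem_univ, true_and] at hmem
        obtain ⟨c, hc⟩ := hmem
        exact hc ((hF _ (hzF i')).2.1 j (Nat.lt_of_succ_lt hj) c)
      rw [pow_succ', Perm.mul_apply, Perm.mul_apply, take_foldl_theta μ θ Fθ hFθ z ((θ ^ j) x) hgoodj i, ih' i]
  have hfix : ∀ j, j < m → z.foldl (fun v c => μ c v) ((θ ^ j) x) = (θ ^ j) x := by
    intro j hj
    have h := htraj j hj z.length
    simp only [List.take_length] at h
    rw [h, hzfix]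
  -- translates crossing the base trajectory are few: at most one per ordered pair of positions
  obtain ⟨B, hB_def⟩ : ∃ B : Finset ℕ, B = (Finset.range m).filter (fun j => ∃ s t : Fin z.length,
      (z.take (s : ℕ)).foldl (fun v c => μ c v) x = (θ ^ j) ((z.take (t : ℕ)).foldl (fun v c => μ c v) x)) :=
    ⟨_, rfl⟩
  have hBcard : B.card ≤ z.length * z.length := by
    have hsub : B ⊆ (Finset.univ : Finset (Fin z.length × Fin z.length)).biUnion
        (fun st => (Finset.range m).filter (fun j => (z.take (st.1 : ℕ)).foldl (fun v c => μ c v) x =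
          (θ ^ j) ((z.take (st.2 : ℕ)).foldl (fun v c => μ c v) x))) := by
      intro j hj
      rw [hB_def] at hj
      simp only [Finset.mem_filter, Finset.mem_range] at hj
      obtain ⟨hjm, s, t, hst⟩ := hj
      simp only [Finset.mem_biUnion, Finset.mem_univ, true_and, Finset.mem_filter, Finset.mem_range]
      exact ⟨(s, t), hjm, hst⟩
    have hfib : ∀ st : Fin z.length × Fin z.length,
        ((Finset.range m).filter (fun j => (z.take (st.1 : ℕ)).foldl (fun v c => μ c v) x =
          (θ ^ j) ((z.take (st.2 : ℕ)).foldl (fun v c => μ c v) x))).card ≤ 1 := by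
      intro st
      refine Finset.card_le_one.2 ?_
      intro a ha b hb
      simp only [Finset.mem_filter, Finset.mem_range] at ha hb
      exact (hF _ (hzF st.2)).2.2 a b ha.1 hb.1 (ha.2.symm.trans hb.2)
    calc B.card ≤ _ := Finset.card_le_card hsub
      _ ≤ ∑ st : Fin z.length × Fin z.length, ((Finset.range m).filter (fun j =>
            (z.take (st.1 : ℕ)).foldl (fun v c => μ c v) x =
              (θ ^ j) ((z.take (st.2 : ℕ)).foldl (fun v c => μ c v) x))).card := Finset.card_biUnion_le
      _ ≤ ∑ _st : Fin z.length × Fin z.length, 1 := Finset.sum_le_sum fun st _ => hfib st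
      _ = z.length * z.length := by simp
  -- hence a non-crossing translate `j ≠ 0`
  have hgoodJ : ∃ j, j < m ∧ j ≠ 0 ∧ j ∉ B := by
    by_contra hno
    push Not at hno
    have hsub : Finset.range m ⊆ insert 0 B := by
      intro j hj
      rw [Finset.mem_range] at hj
      rw [Finset.mem_insert]
      by_cases h0 : j = 0
      · exact Or.inl h0
      · exact Or.inr (hno j hj h0)
    have h1 : m ≤ B.card + 1 := by
      calc m = (Finset.range m).card := (Finset.card_range m).symm
        _ ≤ (insert 0 B).card := Finset.card_le_card hsub
        _ ≤ B.card + 1 := Finset.card_insert_le _ _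
    have h2 : z.length * z.length ≤ (4 * L + 2) ^ 2 := by
      rw [sq]; exact Nat.mul_le_mul hzle hzle
    omega
  obtain ⟨j, hjm, _, hjB⟩ := hgoodJ
  have hjB' : ∀ s t : Fin z.length, (z.take (s : ℕ)).foldl (fun v c => μ c v) x ≠
      (θ ^ j) ((z.take (t : ℕ)).foldl (fun v c => μ c v) x) := by
    intro s t h
    exact hjB (by
      rw [hB_def]
      simp only [Finset.mem_filter, Finset.mem_range]
      exact ⟨hjm, s, t, h⟩)
  -- the clean twin `(x, θ^j x)` (siege seat k20's `patternPair_cleanWalk`)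
  obtain ⟨k, p, q, col, h1, h2, h3, h4, h5, hk⟩ := patternPair_cleanWalk n μ R z x ((θ ^ j) x) hz2 hzc hzfix
    (hfix j hjm)
    (fun s t => by
      rw [htraj j hjm, htraj j hjm]
      exact ⟨fun h => by rw [h], fun h => (θ ^ j).injective h⟩)
    (fun s t => by
      rw [htraj j hjm]
      exact hjB' s t)
    (fun t => by
      have h := (hF _ (hzF t)).1 0 (by omega)
      simpa using h)
    (fun t => by
      rw [htraj j hjm]
      exact (hF _ (hzF t)).1 j hjm)
  exact ⟨k, p, q, col, h1, h2, h3, h4, h5, by omega, by omega⟩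

/-! ## Registered form (`stub-add`ed on the crux item; signature verbatim) -/

/-- **Registered form `stub_largeOrderSymmetryWalk`** (crux `stmt-MatrixMultiplication-10883`, helper stub of siege seat
k25): `largeOrderSymmetry_cleanWalk` verbatim. [folklore] -/
theorem stub_largeOrderSymmetryWalk : ∀ (n L m : ℕ) (μ : Fin 3 → Equiv.Perm (Fin n)), (∀ c, μ c * μ c = 1) → (∀ c v, μ c v ≠ v) → ∀ (θ : Equiv.Perm (Fin n)) (R F : Finset (Fin n)), (∀ v, v ∉ F → (∀ j, j < m → (θ ^ j) v ∉ R) ∧ (∀ j, j < m → ∀ c, θ (μ c ((θ ^ j) v)) = μ c (θ ((θ ^ j) v))) ∧ (∀ j j', j < m → j' < m → (θ ^ j) v = (θ ^ j') v → j = j')) → (4 * L + 2) ^ 2 + 2 ≤ m → n * (n - 1) + 2 ^ L * ((2 * L + 2) * F.card) < 2 ^ L * n → ∃ (k : ℕ) (p q : Fin (k + 1) → Fin n) (col : Fin (k + 1) → Fin 3), (∀ i, p i ≠ q i) ∧ (∀ i, (μ (col i) (p i) = p (i + 1) ∧ μ (col i) (q i) = q (i + 1)) ∨ (μ (col i) (p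 i) = q (i + 1) ∧ μ (col i) (q i) = p (i + 1))) ∧ (∀ i, col i ≠ col (i + 1)) ∧ (∀ i j, (p i = p j ∧ q i = q j) ∨ (p i = q j ∧ q i = p j) ∨ (p i ≠ p j ∧ p i ≠ q j ∧ q i ≠ p j ∧ q i ≠ q j)) ∧ (∀ i, p i ∉ R ∧ q i ∉ R) ∧ 2 ≤ k + 1 ∧ k + 1 ≤ 4 * L + 2 :=
  largeOrderSymmetry_cleanWalk

end Summit.MatrixMultiplication.MatrixMultiplication.Theorems.HyperoctahedralThreshold
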